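import Summits.RiemannHypothesis.RiemannHypothesis.Theorems.TiltedLandingLaw421R3RateLightIsolatedChild
/-! # RATE helper — K-3c: three corollaries of K-3b `RhW08.LightIsolatedChild.lowChildAt_of_light_isolated` (token 30). TOUCH class, rung R1uᵀ of ⟨33346⟩
`TiltedLandingLaw421R`, route EarlyAppointments; W-08 C4 desk rh-idea-6 g39; director (CA663)(B): image 70 → `…R3RateLightChildCorollaries`, lands after 30. The DOOR binder
is implied by the BELOW binder (`λ > 9 > 1`); ★ `lowChildAt_of_lightAt` = the `RhW08.PerturbativeRung.LightAt μ₀` form (μ₀ = 2 ⇒ λ_N > 27). No law is typed or weakened. -/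

namespace RhW08.LightIsolatedChild

open Complex
open scoped ComplexConjugate
open RhW08.PerturbativeRung (fieldK fieldK_dslope LightWitness LightAt)
open RhW08.AntiEscapeSplit7 (newtonK)
open RhW08.UncoveredSplit (LowChildAt)

/-- (K) the DOOR smallness is implied by the BELOW margin: `0 ≤ M`, `9(1+M) < λ` ⇒ `(9/2)(1+M) ≤ λ²/2` (as `λ > 9 > 1`, `λ ≤ λ²`). -/
theorem door_of_below {M lam : ℝ} (hM : 0 ≤ M) (hbelow : 9 * (1 + M) < lam) : 9 / 2 * (1 + M) ≤ lam ^ 2 / 2 := by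
  nlinarith

open RhIdea6.G17.W07C7 RhIdea6.G17.W07C7.Rev6 RhIdea6.G18.W07C8.Law421BirthS RhIdea6.G19.W07C11.Seam RhIdea6.G20.W07C12.Frac
  RhIdea6.G20.W07C12.StColP RhW07.C12.FieldSplit RhW08.Round1 RhW08.StSwap RhW08.Round2 RhW08.QuadW RhW08.SealSwapQ in
/-- ★ K-3b with SEVEN binders: the door binder of `lowChildAt_of_light_isolated` is discharged by `door_of_below`. -/
theorem lowChildAt_of_light_isolated' {η : ℝ} {f : ℂ → ℂ} {x₀ s hmax R Hs : ℝ} {B : ℕ} (hE : EngineHyps5 2 η f x₀ s hmax R Hs B)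
    {j : ℕ} {v : ℂ} (hFv : iteratedDeriv j f v = 0) (hv : 0 < v.im) {M : ℝ} (hM : 0 ≤ M)
    (hW : LightWitness (dslope (iteratedDeriv j f) v) v M) (hbelow : 9 * (1 + M) < v.im * ‖newtonK f j v‖)
    (hiso : ∀ z : ℂ, iteratedDeriv j f z = 0 → |z.re - v.re| < R / 2 → z = v ∨ z = conj v) :
    LowChildAt f j v :=
  lowChildAt_of_light_isolated hE hFv hv hM hW (door_of_below hM hbelow) hbelow hiso

open RhIdea6.G17.W07C7 RhIdea6.G17.W07C7.Rev6 RhIdea6.G18.W07C8.Law421BirthS RhIdea6.G19.W07C11.Seam RhIdea6.G20.W07C12.Frac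
  RhIdea6.G20.W07C12.StColP RhW07.C12.FieldSplit RhW08.Round1 RhW08.StSwap RhW08.Round2 RhW08.QuadW RhW08.SealSwapQ in
/-- ★ K-3b on the LIGHT population of RUNG-P's split: `LightAt μ₀ f j v` (some light witness `M ≤ μ₀`) and the field floor `9(1+μ₀) < λ_N`,
`λ_N = Im v·‖newtonK f j v‖`, give `LowChildAt f j v` at an `R/2`-isolated upper zero (e.g. `μ₀ = 2`, `λ_N > 27`). -/
theorem lowChildAt_of_lightAt {η : ℝ} {f : ℂ → ℂ} {x₀ s hmax R Hs : ℝ} {B : ℕ} (hE : EngineHyps5 2 η f x₀ s hmax R Hs B)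
    {j : ℕ} {v : ℂ} (hFv : iteratedDeriv j f v = 0) (hv : 0 < v.im) {μ₀ : ℝ} (hL : LightAt μ₀ f j v)
    (hbelow : 9 * (1 + μ₀) < v.im * ‖newtonK f j v‖)
    (hiso : ∀ z : ℂ, iteratedDeriv j f z = 0 → |z.re - v.re| < R / 2 → z = v ∨ z = conj v) :
    LowChildAt f j v := by
  obtain ⟨M, hMμ, hW⟩ := hL
  exact lowChildAt_of_light_isolated' hE hFv hv hW.2.1 hW (by nlinarith [hW.2.1]) hiso

end RhW08.LightIsolatedChild
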